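import Mathlib
import Literature.Barriers.NavierStokesRegularity.DyadicCascadeExistence
import Literature.Barriers.NavierStokesRegularity.DyadicCascadeUniqueness
import Literature.Barriers.NavierStokesRegularity.DyadicSmoothing
import HarnessLib

/-!
# Proof of Barbato–Morandin–Romito 2011, Theorem 1
  (the named fact `Dyadic.BarbatoMorandinRomito2011_thm1` = the barrier `DyadicCascadeRegularity`)

Barrier catalogue `Literature/Barriers/NavierStokesRegularity/`, **assembly file**: we prove
`theorem BarbatoMorandinRomito2011_thm1_holds : BarbatoMorandinRomito2011_thm1` — for `ν > 0`,
`β ∈ (2, 5/2]`, `λ = 2` and every datum with `xₙ ≥ 0`, `∑xₙ² < ∞` the viscous dyadic model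
(1.1) has a weak solution (BMR Def. 3.1) which is `ℓ²`-valued, non-negative, smooth
(`supₙ λₙ^γXₙ(t) < ∞` for all `γ > 0`, `t > 0`) and unique among all weak solutions — and hence
the catalogue entry `dyadicCascadeRegularity_holds : DyadicCascadeRegularity`.

## The proof (BMR §3.2, pp. 7–8 of the arXiv text) and where each step is formalised

* existence of a global weak solution for non-negative `ℓ²` data (BMR §3, first bullet, from
  Cheskidov 2008 Thm. 4.1): `exists_isBMRWeakSolution` (`DyadicCascadeExistence`, sibling file);
* positivity, `ℓ²` bound, energy inequality (BMR §3, second bullet; Cheskidov Thm. 4.2):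
  `DyadicCascadePositivity` (sibling file);
* uniqueness among weak solutions (Prop. 3.2, `β ≤ 3`): `IsBMRWeakSolution.unique`
  (`DyadicCascadeUniqueness`, sibling file);
* "Let `t₀ > 0` be one of these [good] times": `IsBMRWeakSolution.exists_goodTime`
  (`DyadicSmoothing`), giving `K₀ = supₙ λₙ^{β-2+ε}Xₙ(t₀) < ∞` with `ε = 1/100`;
* "the solutions `Ȳ^{(N)}` of (e:YNeq) converge to `Ȳ`": the truncations from the datum `X(t₀)`
  with BMR's closure `X_{N+1} = λ^{-(β-2+ε)}X_N` (`exists_truncated_solution`,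
  `exists_weakSolution_of_truncated`, sibling file) converge along a subsequence to a weak solution
  from `X(t₀)`, which is `X(t₀ + ·)` by uniqueness and the time-shift invariance;
* "Lemma 2.1 ensures that `Yₙ^{(N)}(t) ≤ 1` and in turns `λ^{β-2+ε}Xₙ(t) ≤ K₀/δ` for all `n ≥ 1`
  and `t ≥ t₀`": `rpow_mul_le_of_truncated` (`DyadicInvariantRegionScaling`, built on the
  invariant-region lemma `invariantRegion_le_one` of `DyadicInvariantRegion` and the certified
  numerics of `DyadicInvariantRegionNumerics`), passed to the limit mode by mode;
* the second claim (smoothness for `t > t₀` from the supercritical bound):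
  `IsBMRWeakSolution.exists_rpow_mul_le_of_decay` (`DyadicSmoothing`), an elementary bootstrap on
  the Duhamel bound of Prop. 3.3 in place of BMR's `Vₙ`/fixed-point argument.

Since `t₀` can be taken in `(0, t/2]` for any prescribed `t > 0`, smoothness holds at every
`t > 0`, as printed. Theorem-only module.

## References

* D. Barbato, F. Morandin, M. Romito, *Smooth solutions for the dyadic model*, Nonlinearity 24
  (2011) 3083–3097, Thm. 1, §2 Lemma 2.1, §3 Prop. 3.2, Prop. 3.3, §3.2 (arXiv:1007.3401).
  [`BarbatoMorandinRomito2011`]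
* A. Cheskidov, Trans. AMS 360 (2008) 5101–5120, §4 Thms. 4.1, 4.2. [`Cheskidov2008`]
-/

noncomputable section

open Set Filter Topology

namespace Literature.Barriers.NavierStokesRegularity

namespace Dyadic

/-- **The supercritical a priori bound from a good time** (BMR §3.2, first claim): let `X` be a
weak solution with non-negative `ℓ²` datum, `ν > 0`, `β ∈ (2, 5/2]`, `a = β - 2 + ε` with
`ε ∈ (0, 1/100]`, and let `t₀ ≥ 0` be a time with `λₙ^a Xₙ(t₀) ≤ K` for all `n ≥ 1` (`K > 0`). Then
`λₙ^a Xₙ(t) ≤ 10K` for all `n ≥ 1`, `t ≥ t₀`. Proof: the truncations from the datum `X(t₀)` with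
closure `X_{N+1} = 2^{-a}X_N` obey the bound by Lemma 2.1 (`rpow_mul_le_of_truncated`), converge
along a subsequence to a weak solution from `X(t₀)` (`exists_weakSolution_of_truncated`), which is
`X(t₀ + ·)` by uniqueness (Prop. 3.2). [cite: BarbatoMorandinRomito2011, §3.2 (proof of Thm. 1, first claim)] -/
theorem IsBMRWeakSolution.rpow_mul_le_of_goodTime {ν β ε a K t₀ : ℝ} {x : ℕ → ℝ} {X : ℕ → ℝ → ℝ}
    (hX : IsBMRWeakSolution ν β x X) (hν : 0 < ν) (hβ2 : 2 < β) (hβ52 : β ≤ 5 / 2)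
    (hε0 : 0 < ε) (hε1 : ε ≤ 1 / 100) (ha : a = β - 2 + ε)
    (hx : ∀ n, 1 ≤ n → 0 ≤ x n) (hx2 : Summable fun n => x n ^ 2) (ht₀ : 0 ≤ t₀) (hK : 0 < K)
    (hinit : ∀ n, 1 ≤ n → bmrLambda n ^ a * X n t₀ ≤ K) :
    ∀ n, 1 ≤ n → ∀ t, t₀ ≤ t → bmrLambda n ^ a * X n t ≤ 10 * K := by
  have hβ0 : β ≠ 0 := by linarith
  have hβpos : 0 < β := by linarith
  -- the datum at the good time
  set z : ℕ → ℝ := fun n => X n t₀ with hz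
  have hzpos : ∀ n, 1 ≤ n → 0 ≤ z n := fun n hn => hX.nonneg hβ0 hx n hn t₀ ht₀
  have hz2 : Summable fun n => z n ^ 2 := hX.summable_sq hβ0 hν.le hx hx2 ht₀
  -- the truncations with BMR's closure, and their limit
  have hκ : (0 : ℝ) ≤ (2 : ℝ) ^ (-a) := (Real.rpow_pos_of_pos (by norm_num) _).le
  choose U hU0 hUN1 hUgt hUinit hUd using
    fun N => exists_truncated_solution (κ := (2 : ℝ) ^ (-a)) hν.le hβ0 hκ z hzpos N
  obtain ⟨φ, Z, hφ, hZ, -, hlim⟩ :=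
    exists_weakSolution_of_truncated hν.le hβ0 hκ hzpos hz2 hU0 hUN1 hUgt hUinit hUd
  -- the limit is `X(t₀ + ·)` by uniqueness
  have hXs : IsBMRWeakSolution ν β z fun n s => X n (s + t₀) := hX.shift ht₀
  have huniq : ∀ n, 1 ≤ n → ∀ s, 0 ≤ s → X n (s + t₀) = Z n s :=
    hXs.unique hZ hν hβpos (by linarith) hzpos hz2
  -- Lemma 2.1 for each truncation
  have htrunc : ∀ N, 1 ≤ N → ∀ n, 1 ≤ n → n ≤ N → ∀ s, 0 ≤ s →
      bmrLambda n ^ a * U N n s ≤ 10 * K := by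
    intro N hN
    have hcontN : ContinuousOn (U N N) (Ici 0) := by
      obtain ⟨M, hM⟩ : ∃ M, N = M + 1 := ⟨N - 1, by omega⟩
      intro τ hτ
      have := (hUd N M (by omega) τ hτ).continuousWithinAt
      rwa [← hM] at this
    have hcontN1 : ContinuousOn (U N (N + 1)) (Ici 0) := by
      have : U N (N + 1) = fun τ => (2 : ℝ) ^ (-a) * U N N τ := funext (hUN1 N)
      rw [this]; exact continuousOn_const.mul hcontN
    have hposN : ∀ m < N, ∀ t, 0 ≤ t → 0 ≤ U N (m + 1) t :=
      nonneg_of_modes hβ0 (hUd N) hcontN1 fun m hm => by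
        rw [hUinit N m hm]; exact hzpos (m + 1) (by omega)
    refine rpow_mul_le_of_truncated (X := U N) (t₀ := 0) hν hβ2 hβ52 hε0 hε1 ha hN hK
      ?_ ?_ (hUN1 N) ?_ ?_
    · intro n hn1 hnN
      obtain ⟨m, rfl⟩ : ∃ m, n = m + 1 := ⟨n - 1, by omega⟩
      exact fun τ hτ => (hUd N m (by omega) τ hτ).continuousWithinAt
    · intro n hn1 hnN τ hτ
      obtain ⟨m, rfl⟩ : ∃ m, n = m + 1 := ⟨n - 1, by omega⟩
      exact (hUd N m (by omega) τ hτ).mono (Ici_subset_Ici.2 hτ)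
    · intro n hn τ hτ
      rcases Nat.eq_zero_or_pos n with rfl | hn1
      · rw [hU0]
      rcases Nat.lt_or_ge n (N + 1) with hlt | hge
      · obtain ⟨m, rfl⟩ : ∃ m, n = m + 1 := ⟨n - 1, by omega⟩
        exact hposN m (by omega) τ hτ
      · have : n = N + 1 := le_antisymm hn hge
        subst this
        rw [hUN1]
        obtain ⟨M, hM⟩ : ∃ M, N = M + 1 := ⟨N - 1, by omega⟩
        have := hposN M (by omega) τ hτ
        rw [← hM] at this
        exact mul_nonneg hκ this
    · intro n hn1 hnN
      obtain ⟨m, rfl⟩ : ∃ m, n = m + 1 := ⟨n - 1, by omega⟩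
      rw [hUinit N m (by omega)]
      exact hinit (m + 1) hn1
  -- pass to the limit along `φ`
  have hlimit : ∀ n, 1 ≤ n → ∀ s, 0 ≤ s → bmrLambda n ^ a * Z n s ≤ 10 * K := by
    intro n hn s hs
    have ht : Tendsto (fun j => bmrLambda n ^ a * U (φ j) n s) atTop
        (𝓝 (bmrLambda n ^ a * Z n s)) := (hlim n s hs).const_mul _
    refine le_of_tendsto ht ?_
    filter_upwards [eventually_ge_atTop n] with j hj
    have hNj : n ≤ φ j := hj.trans (hφ.id_le j)
    exact htrunc (φ j) (hn.trans hNj) n hn hNj s hs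
  -- back to `X`
  intro n hn t ht
  have := hlimit n hn (t - t₀) (by linarith)
  rwa [← huniq n hn (t - t₀) (by linarith), sub_add_cancel] at this

/-- **Barbato–Morandin–Romito 2011, Theorem 1** (global existence, positivity, smoothness and
uniqueness of weak solutions of the viscous dyadic model for `β ∈ (2, 5/2]`, `λ = 2`, `ν > 0` and
non-negative `ℓ²` data), proved: the named fact `BarbatoMorandinRomito2011_thm1` holds. See the
module docstring for the architecture of the proof. [cite: BarbatoMorandinRomito2011, §1.1 Thm. 1, §2 Lemma 2.1, §3 Prop. 3.2 and §3.2] -/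
theorem BarbatoMorandinRomito2011_thm1_holds : BarbatoMorandinRomito2011_thm1 := by
  intro ν β hν hβ2 hβ52 x hx hx2
  have hβ0 : β ≠ 0 := by linarith
  have hβpos : 0 < β := by linarith
  obtain ⟨X, hX, -⟩ := exists_isBMRWeakSolution hν.le hβ0 hx hx2
  refine ⟨X, hX, fun t ht => hX.summable_sq hβ0 hν.le hx hx2 ht,
    fun n hn t ht => hX.nonneg hβ0 hx n hn t ht, ?_, ?_⟩
  · -- smoothness at every `t > 0`
    intro γ hγ t ht
    -- a good time `t₀ ∈ [t/4, t/2]`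
    obtain ⟨t₀, ht₀mem, B, hB⟩ := hX.exists_goodTime hν hβ0 hx hx2 (T := t / 2) (by linarith)
    have ht₀0 : 0 ≤ t₀ := by linarith [ht₀mem.1]
    have ht₀t : t₀ < t := by linarith [ht₀mem.2]
    have hB0 : 0 ≤ B := by simpa using hB 0
    -- the supercritical weight at `t₀`: `λₙ^a Xₙ(t₀) ≤ λₙXₙ(t₀) ≤ 1 + λₙ²Xₙ(t₀)² ≤ 1 + B`
    set a : ℝ := β - 2 + 1 / 100 with ha
    have ha1 : a ≤ 1 := by rw [ha]; linarith
    have hinit : ∀ n, 1 ≤ n → bmrLambda n ^ a * X n t₀ ≤ 1 + B := by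
      intro n hn
      obtain ⟨m, rfl⟩ : ∃ m, n = m + 1 := ⟨n - 1, by omega⟩
      have hXn : 0 ≤ X (m + 1) t₀ := hX.nonneg hβ0 hx (m + 1) hn t₀ ht₀0
      have h1 : bmrLambda (m + 1) ^ a ≤ bmrLambda (m + 1) := by
        have := Real.rpow_le_rpow_of_exponent_le (one_le_bmrLambda (by omega : m + 1 ≠ 0)) ha1
        rwa [Real.rpow_one] at this
      have h2 : bmrLambda (m + 1) ^ 2 * X (m + 1) t₀ ^ 2 ≤ B := by
        have := hB (m + 1)
        rw [Finset.sum_range_succ] at this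
        linarith [Finset.sum_nonneg (fun i _ => by positivity :
          ∀ i ∈ Finset.range m, (0 : ℝ) ≤ bmrLambda (i + 1) ^ 2 * X (i + 1) t₀ ^ 2)]
      calc bmrLambda (m + 1) ^ a * X (m + 1) t₀ ≤ bmrLambda (m + 1) * X (m + 1) t₀ :=
            mul_le_mul_of_nonneg_right h1 hXn
        _ ≤ 1 + (bmrLambda (m + 1) * X (m + 1) t₀) ^ 2 := by
            nlinarith [sq_nonneg (bmrLambda (m + 1) * X (m + 1) t₀ - 1)]
        _ ≤ 1 + B := by rw [mul_pow]; linarith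
    -- Lemma 2.1: the weighted bound persists (times `10`) for `t ≥ t₀`
    have hdec := hX.rpow_mul_le_of_goodTime hν hβ2 hβ52 (by norm_num : (0 : ℝ) < 1 / 100) le_rfl
      ha hx hx2 ht₀0 (by linarith : (0 : ℝ) < 1 + B) hinit
    -- the bootstrap
    exact hX.exists_rpow_mul_le_of_decay hν hβ2 hx hx2 (q₀ := a) (by rw [ha]; linarith) ht₀0 hdec γ
      ht₀t
  · -- uniqueness among weak solutions (Prop. 3.2)
    intro Y hY n hn t ht
    exact (hX.unique hY hν hβpos (by linarith) hx hx2 n hn t ht).symm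

end Dyadic

/-- **The barrier `DyadicCascadeRegularity` holds** (it is BMR's Theorem 1 by definition).
[cite: BarbatoMorandinRomito2011, §1.1 Thm. 1] -/
theorem dyadicCascadeRegularity_holds : DyadicCascadeRegularity :=
  Dyadic.BarbatoMorandinRomito2011_thm1_holds

end Literature.Barriers.NavierStokesRegularity
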